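import Literature.LinearAlgebra.Matrix.IntegerMatrixBinaryQuadraticForms
import Literature.NumberTheory.QuadraticFields.BinaryQuadraticFormsRepresentation
import Mathlib.Algebra.Polynomial.SpecificDegree
import Mathlib.Data.Rat.Lemmas
import HarnessLib

/-!
# Hertling–Larabi 2026b THEOREM 7.10: Legendre reduction of integer `2 × 2` matrices with irreducible
# characteristic polynomial under `SL₂(ℤ)`-conjugation — the finite set `M(r, s)` of (semi-)normal forms,
# representatives of every class (types IV and V), and UNIQUE representatives for type V (`D < 0`)

[topic LinearAlgebra/Matrix] Sequel to `IntegerMatrixBinaryQuadraticForms` (HL26b Lemma 7.2 (b): the dictionary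
`(a b; c d) ↦ [c, d − a, −b]_quad` between integer `2 × 2` matrices of fixed trace and binary quadratic forms,
`SL₂(ℤ)`-conjugacy ↔ proper equivalence) and to the singular / rational-eigenvalue normal forms
(`GL2ZSingularNormalForms`, `GL2ZRationalEigenvaluesNormalForms`: types I–III).  Here: the IRREDUCIBLE case
(types IV and V of HL26b Lemma 7.6: `4D = (tr B)² − 4 det B` is not a square), i.e. Legendre's reduction
algorithm for `SL₂(ℤ)`-conjugacy classes.  Lane `lit-hodgefound` (Track 2 foundations library), seat p19
generation 39, row g39-#1.  THEOREMS ONLY: no definition, no instance, no notation, no named fact (D-0026, net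
Literature debt `0`), no `sorry`.

Conventions.  `B = (a b; c d)` is `!![a, b; c, d]`, so `a = B 0 0`, `b = B 0 1`, `c = B 1 0`, `d = B 1 1`; the
`SL₂(ℤ)`-conjugacy relation is written as in `IntegerMatrixBinaryQuadraticForms`: `B' = γ⁻¹Bγ` is
`γ.det = 1 ∧ γ * B' = B * γ`.  HL's discriminant is `D = r²/4 − s` for `f = t² − rt + s`; we work with the
integer `4D = r² − 4s = (a − d)² + 4bc`.  HL's set of (semi-)normal forms
`M(r, s) = {(a b; c d) ∈ M_{2×2}(ℤ) | a + d = r, ad − bc = s, 0 < |c| ≤ |b|, a − d ∈ (−|c|, |c|], in the case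
|c| = |b|: a − d ∈ [0, |c|]}`
is written out in place as the set of `B` with
`B.trace = r ∧ B.det = s ∧ B 1 0 ≠ 0 ∧ |B 1 0| ≤ |B 0 1| ∧ -|B 1 0| < B 0 0 - B 1 1 ∧ B 0 0 - B 1 1 ≤ |B 1 0| ∧
(|B 1 0| = |B 0 1| → 0 ≤ B 0 0 - B 1 1)`.

## Source, VERBATIM

C. Hertling, K. Larabi, *Conjugacy classes of regular integer matrices*, arXiv:2602.15748 (2026)
[HertlingLarabi2026b], held `paper:arxiv-2602.15748`, §7.3, chunks p0017–p0018:
«`T = (1 1; 0 1)`, `S = (0 −1; 1 0)` and `D_{1,−1} = (1 0; 0 −1)`. It is well known that `SL_2(ℤ)` is generated by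
`S`, `T` and `−E_2` […]. The matrices `S`, `T` and `D_{1,−1}` act on `M_{2×2}(ℤ)` by conjugation as follows,
`T⁻¹(a b; c d)T = (a−c, a+b−c−d; c, d+c)`, `S⁻¹(a b; c d)S = (d, −c; −b, a)`,
`D_{1,−1}⁻¹(a b; c d)D_{1,−1} = (a, −b; −c, d)`.
The algorithm in the proof of part (c)(i) of Theorem 7.10 is ascribed to Legendre in [Tr13].
**Theorem 7.10.** Let `f(t) = t² − rt + s ∈ ℤ[t]` be irreducible with roots `λ_{1/2}` and discriminant `D` as
above.
(a) Each matrix `B = (a b; c d) ∈ M_{2×2}(ℤ)` with characteristic polynomial `f` satisfies `bc ≠ 0`. If `D < 0`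
then `bc < 0`.
(b) The set `M(r, s) := {(a b; c d) ∈ M_{2×2}(ℤ) | a + d = r, ad − bc = s, 0 < |c| ≤ |b|, a − d ∈ (−|c|, |c|], in
the case |c| = |b| a − d ∈ [0, |c|]}` is finite and not empty.
(c) (i) Each `SL_2(ℤ)`-conjugacy class of matrices in `M_{2×2}(ℤ)` with characteristic polynomial `f` has
representatives in `M(r, s)`.
(ii) In the case of type IV these representatives are called semi-normal forms.
(iii) In the case of type V there is exactly one such representative. It is called normal form.
Proof: (a) `4D = (a−d)² + 4bc` is not a square because `f` is irreducible. Therefore `bc ≠ 0`. If `D < 0` then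
`bc < 0`.
(b) The case `D < 0`: `|c| ≤ |b|` and `a − d ∈ (−|c|, |c|]` imply `c² ≤ |b||c| = −bc = ((a−d)/2)² − D ≤ ¼c² − D`,
so `c² ≤ (4/3)|D|` […] `|a − r/2| = |d − r/2| = |(a−d)/2| ≤ |c|/2` […] `|b| ≤ ¼c² − D ≤ (4/3)|D|`.  Therefore the
set `M(r, s)` is finite.  The case `D > 0`: First we show `bc > 0`. Suppose `bc < 0`. Then
`c² ≤ |b||c| = −bc ≤ ¼c² − D`, so `¾c² ≤ −D < 0`, a contradiction. So `bc > 0`. Then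
`c² ≤ bc = D − ((a−d)/2)² ≤ D`, […] `|b| ≤ D` because `|c| ≥ 1`. […] In both cases the set `M(r, s)` is not empty
because of part (c)(i) and because one has always the `SL_2(ℤ)`-conjugacy class of the matrix `(0 −s; 1 r)`.
(c) (i) […] Step 1: Go from `B` to `T^{−k}BT^k` for the unique `k ∈ ℤ` with `a − d − 2kc ∈ (−|c|, |c|]`. Then
`c̃ = c`, `ã − d̃ ∈ (−|c̃|, |c̃|]`. If then `|c̃| ≤ |b̃|` go to Step 3, else go to Step 2.  Step 2: Here `|b| < |c|`.
Go from `B` to `S⁻¹BS`. Then `|c̃| = |b| < |c|`. Go to Step 1.  At some point one goes from Step 1 to Step 3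
because `|b|, |c| ∈ ℕ` and each application of Step 2 diminishes `|c|` strictly.  Step 3: Now `|c| ≤ |b|` and
`a − d ∈ (−|c|, |c|]`. Stop if `|c| < |b|` or if `|c| = |b|` and `a − d ∈ [0, |c|]`. If `|c| = |b|` and
`a − d ∈ (−|c|, 0)` go from `B` to `S⁻¹BS`. Then `|c̃| = |b̃| = |c| = |b|` and `ã − d̃ = d − a ∈ (0, |c|)`.
(iii) Now `D < 0`. […] Either all matrices `(a b; c d)` in it satisfy `c > 0` (1st case) or all matrices in it
satisfy `c < 0` (2nd case). […] It is well known (e.g. [Se73]) that the `PSL_2(ℤ)` orbit of any `z ∈ ℍ` intersects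
each of the two fundamental domains `F_1`, `F_2` […] in precisely one point. […] Therefore the
`SL_2(ℤ)`-conjugacy class above contains exactly one matrix in `M(r, s)`. □
**Examples 7.11.** (i) […] `M(0, 5) = {(0 −5; 1 0), (0 5; −1 0), (1 −3; 2 −1), (1 3; −2 −1)}`. Therefore there
are four `SL_2(ℤ)`-conjugacy classes and two `GL_2(ℤ)`-conjugacy classes […].»
Lemma 7.6 (chunk p0015): «(e) `B` is of type IV ⟺ `D > 0` and `4D ∈ ℕ` is not a square. (f) `B` is of type V ⟺
`D < 0`.»

## What is proved, and the one deviation from the printed proof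

* §1 the three conjugation formulas (for `T^k`, `S`, `D_{1,−1}`) and `SL₂(ℤ)`-conjugacy as an equivalence.
* §2 **(a)**: `mul_ne_zero_of_not_isSquare` (`bc ≠ 0`), `mul_neg_of_discr_neg` (`bc < 0` for `D < 0`), and
  the dictionary `irreducible_iff_not_isSquare`: `t² − rt + s` is irreducible over `ℚ` iff `r² − 4s` is not a
  square — the hypothesis of the theorem in the form the proofs use it («`4D` is not a square because `f` is
  irreducible»).
* §3 **(b)**: the printed bounds in integers (`3c² ≤ −4D`, `3|b| ≤ −4D`, `|a − d| ≤ |c|` for `D < 0`;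
  `bc > 0`, `4c² ≤ 4D`, `4|b| ≤ 4D` for `D ≥ 0`), `finite_normalForms` (for EVERY `r, s`),
  `normalForms_nonempty` (for `r² − 4s` not a square).
* §4 **(c)(i)** (Legendre's algorithm, by strong induction on `|c|` exactly along Steps 1–3):
  `exists_sl2_conj_normalForm` (entries) and `exists_sl2_conj_mem` (matrices).
* §5 **(c)(iii)**: `pos_iff_pos_of_sl2_conj` («either all matrices in it satisfy `c > 0` or all `c < 0`»),
  `normalForm_unique_of_discr_neg`, `existsUnique_sl2_conj_mem_of_discr_neg`, and the count
  `natCard_quot_sl2_conj_eq` (the `SL₂(ℤ)`-classes with `tr = r`, `det = s`, `r² − 4s < 0`, are in bijection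
  with `M(r, s)`).  DEVIATION: HL prove uniqueness through the fundamental domains `F_1, F_2 ⊂ ℍ` of `PSL₂(ℤ)`
  ([Se73]); Mathlib's `ModularGroup` uniqueness statement covers only the interior of the fundamental domain, so
  we go instead through Lemma 7.2 (b) and the tree's Cox Thm. 2.8 (uniqueness of the REDUCED form,
  `BinaryQuadraticFormsRepresentation.eq_of_properEquiv_of_isReduced`), extended here to non-primitive forms by
  removing the content (`binQF_eq_of_properEquiv_of_isReduced`).  The bridge is **`mem_normalForms_iff_isReduced`:
  `(a b; c d) ∈ M(r, s)` iff the positive definite form `[|c|, a − d, |b|]` is reduced in Cox's sense** — this is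
  the precise relation between HL's boundary conventions (`a − d ∈ (−|c|, |c|]`, `F_1`) and Cox's (`|b| ≤ a ≤ c`,
  `b ≥ 0` on the boundary).
* §6 **Examples 7.11 (i)**: `normalForms_zero_five` (`M(0, 5)` is the printed four-element set) and
  `natCard_quot_sl2_conj_zero_five` (four `SL₂(ℤ)`-classes with characteristic polynomial `t² + 5`).
NOT here: (c)(ii) is a naming convention; Theorem 7.9 (the comparison with `GL₂(ℤ)`-classes and `(ε+)`-classes
of lattices); the continued-fraction theory of the semi-normal forms (type IV).

## References

* [HertlingLarabi2026b] C. Hertling, K. Larabi, arXiv:2602.15748 (2026), §7.3 Theorem 7.10 with proof and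
  Examples 7.11 (i) (chunks p0017–p0018), Lemma 7.6 (chunk p0015), Lemma 7.2 (b) (chunk p0014).
  [cite: HertlingLarabi2026b, §7.3 Theorem 7.10, chunks p0017–p0018]
* [Cox2013] D. A. Cox, *Primes of the form x² + ny²*, 2nd ed., §2.A Thm. 2.8 (the tree's `BinQF.IsReduced`,
  `eq_of_properEquiv_of_isReduced`).
* J.-P. Serre, *A course in arithmetic* (1973), Ch. VII §1 (HL's [Se73], the fundamental domain; not used here).
-/

namespace Literature.LinearAlgebra.Matrix.SL2ZIrreducibleNormalForms

open _root_.Polynomial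
open Literature.NumberTheory.QuadraticFields.Quadratic (BinQF)
open Literature.NumberTheory.QuadraticFields.Quadratic.BinQF
open Literature.LinearAlgebra.Matrix.IntegerMatrixBinQF

/-! ## §1 The conjugation action of `T^k`, `S`, `D_{1,−1}`; `SL₂(ℤ)`-conjugacy is an equivalence -/

/-- **`T^{−k} (a b; c d) T^k = (a − kc, b + k(a − d) − k²c; c, d + kc)`** for `T = (1 1; 0 1)` (HL, `k = 1`:
«`T⁻¹(a b; c d)T = (a−c, a+b−c−d; c, d+c)`»), written as `T^k · (T^{−k}BT^k) = B · T^k`.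
[cite: HertlingLarabi2026b, §7.3 (conjugation formulas before Theorem 7.10), chunk p0017] -/
theorem T_conj (a b c d k : ℤ) :
    (!![1, k; 0, 1] : Matrix (Fin 2) (Fin 2) ℤ) * !![a - k * c, b + k * (a - d) - k ^ 2 * c; c, d + k * c] =
      !![a, b; c, d] * !![1, k; 0, 1] := by
  ext i j
  fin_cases i <;> fin_cases j <;> simp [Matrix.mul_apply, Fin.sum_univ_two] <;> ring

/-- `det T^k = 1`. [cite: HertlingLarabi2026b, §7.3, chunk p0017] -/
theorem det_T (k : ℤ) : (!![1, k; 0, 1] : Matrix (Fin 2) (Fin 2) ℤ).det = 1 := by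
  rw [Matrix.det_fin_two_of]; ring

/-- **`S⁻¹ (a b; c d) S = (d, −c; −b, a)`** for `S = (0 −1; 1 0)`, written as `S · (S⁻¹BS) = B · S`.
[cite: HertlingLarabi2026b, §7.3 (conjugation formulas before Theorem 7.10), chunk p0017] -/
theorem S_conj (a b c d : ℤ) :
    (!![0, -1; 1, 0] : Matrix (Fin 2) (Fin 2) ℤ) * !![d, -c; -b, a] = !![a, b; c, d] * !![0, -1; 1, 0] := by
  ext i j
  fin_cases i <;> fin_cases j <;> simp [Matrix.mul_apply, Fin.sum_univ_two]

/-- `det S = 1`. [cite: HertlingLarabi2026b, §7.3, chunk p0017] -/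
theorem det_S : (!![0, -1; 1, 0] : Matrix (Fin 2) (Fin 2) ℤ).det = 1 := by
  rw [Matrix.det_fin_two_of]; ring

/-- **`D_{1,−1}⁻¹ (a b; c d) D_{1,−1} = (a, −b; −c, d)`** for `D_{1,−1} = diag(1, −1)` (`∈ GL₂(ℤ) ∖ SL₂(ℤ)`),
written as `D · (D⁻¹BD) = B · D`. [cite: HertlingLarabi2026b, §7.3 (conjugation formulas before Theorem 7.10), chunk p0017] -/
theorem D_conj (a b c d : ℤ) :
    (!![1, 0; 0, -1] : Matrix (Fin 2) (Fin 2) ℤ) * !![a, -b; -c, d] = !![a, b; c, d] * !![1, 0; 0, -1] := by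
  ext i j
  fin_cases i <;> fin_cases j <;> simp [Matrix.mul_apply, Fin.sum_univ_two]

/-- Composition of `SL₂(ℤ)`-conjugations: `B₁ = γ₁⁻¹Bγ₁`, `B₂ = γ₂⁻¹B₁γ₂` ⟹ `B₂ = (γ₁γ₂)⁻¹B(γ₁γ₂)`. [folklore] -/
private theorem conj_trans {B B₁ B₂ : Matrix (Fin 2) (Fin 2) ℤ}
    (h₁ : ∃ γ : Matrix (Fin 2) (Fin 2) ℤ, γ.det = 1 ∧ γ * B₁ = B * γ)
    (h₂ : ∃ γ : Matrix (Fin 2) (Fin 2) ℤ, γ.det = 1 ∧ γ * B₂ = B₁ * γ) :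
    ∃ γ : Matrix (Fin 2) (Fin 2) ℤ, γ.det = 1 ∧ γ * B₂ = B * γ := by
  obtain ⟨γ₁, h₁d, h₁⟩ := h₁
  obtain ⟨γ₂, h₂d, h₂⟩ := h₂
  refine ⟨γ₁ * γ₂, by rw [Matrix.det_mul, h₁d, h₂d, one_mul], ?_⟩
  rw [Matrix.mul_assoc, h₂, ← Matrix.mul_assoc, h₁, Matrix.mul_assoc]

/-- Inversion of an `SL₂(ℤ)`-conjugation: `B' = γ⁻¹Bγ` ⟹ `B = adj(γ)⁻¹ B' adj(γ)`. [folklore] -/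
private theorem conj_symm {B B' : Matrix (Fin 2) (Fin 2) ℤ}
    (h : ∃ γ : Matrix (Fin 2) (Fin 2) ℤ, γ.det = 1 ∧ γ * B' = B * γ) :
    ∃ γ : Matrix (Fin 2) (Fin 2) ℤ, γ.det = 1 ∧ γ * B = B' * γ := by
  obtain ⟨γ, hd, h⟩ := h
  have hB' : B' = γ.adjugate * B * γ := by
    rw [eq_smul_adjugate_mul_mul (by rw [hd, one_pow]) h, hd, one_smul]
  refine ⟨γ.adjugate, by rw [Matrix.det_adjugate, hd, one_pow], ?_⟩
  rw [hB', Matrix.mul_assoc, Matrix.mul_assoc, Matrix.mul_adjugate, hd, one_smul, Matrix.mul_one]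

/-- `SL₂(ℤ)`-conjugate matrices have the same trace and determinant (the same characteristic polynomial).
[cite: HertlingLarabi2026b, §7.1 Lemma 7.2 (b), chunk p0014] -/
theorem trace_eq_and_det_eq_of_sl2_conj {B B' γ : Matrix (Fin 2) (Fin 2) ℤ} (hγ : γ.det = 1)
    (h : γ * B' = B * γ) : B'.trace = B.trace ∧ B'.det = B.det := by
  have hB' : B' = γ.adjugate * B * γ := by
    rw [eq_smul_adjugate_mul_mul (by rw [hγ, one_pow]) h, hγ, one_smul]
  refine ⟨by rw [hB', trace_adjugate_mul_mul, hγ, one_mul], ?_⟩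
  rw [hB', Matrix.det_mul, Matrix.det_mul, Matrix.det_adjugate, hγ, one_pow, one_mul, mul_one]

/-- **`SL₂(ℤ)`-conjugacy is an equivalence relation** on the integer `2 × 2` matrices of trace `r` and
determinant `s` (the classes counted in Theorem 7.10). [cite: HertlingLarabi2026b, §7.1 Rem. 7.3 (ii), chunk p0015] -/
theorem equivalence_sl2_conj (r s : ℤ) :
    Equivalence fun B B' : {B : Matrix (Fin 2) (Fin 2) ℤ // B.trace = r ∧ B.det = s} =>
      ∃ γ : Matrix (Fin 2) (Fin 2) ℤ, γ.det = 1 ∧ γ * B'.1 = B.1 * γ where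
  refl B := ⟨1, Matrix.det_one, by rw [Matrix.one_mul, Matrix.mul_one]⟩
  symm h := conj_symm h
  trans h h' := conj_trans h h'

/-! ## §2 THEOREM 7.10 (a): `bc ≠ 0`; `bc < 0` if `D < 0` -/

/-- **THEOREM 7.10 (a), first sentence**: if `4D = (a + d)² − 4(ad − bc) = (a − d)² + 4bc` is not a square
(«because `f` is irreducible») then `bc ≠ 0`. [cite: HertlingLarabi2026b, §7.3 Theorem 7.10 (a), chunk p0017] -/
theorem mul_ne_zero_of_not_isSquare {a b c d : ℤ} (h : ¬ IsSquare ((a + d) ^ 2 - 4 * (a * d - b * c))) :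
    b * c ≠ 0 := by
  intro hbc
  exact h ⟨a - d, by linear_combination 4 * hbc⟩

/-- **THEOREM 7.10 (a), second sentence**: if `D < 0`, i.e. `(a + d)² − 4(ad − bc) < 0`, then `bc < 0`.
[cite: HertlingLarabi2026b, §7.3 Theorem 7.10 (a), chunk p0017] -/
theorem mul_neg_of_discr_neg {a b c d : ℤ} (h : (a + d) ^ 2 - 4 * (a * d - b * c) < 0) : b * c < 0 := by
  nlinarith [sq_nonneg (a - d)]

/-- For type V (`(tr B)² − 4 det B < 0`) the irreducibility hypothesis «`(tr B)² − 4 det B` is not a square» is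
automatic. [cite: HertlingLarabi2026b, §7.2 Lemma 7.6 (f), chunk p0015] -/
theorem not_isSquare_discr_of_neg {B : Matrix (Fin 2) (Fin 2) ℤ} (h : B.trace ^ 2 - 4 * B.det < 0) :
    ¬ IsSquare (B.trace ^ 2 - 4 * B.det) := by
  rintro ⟨x, hx⟩
  nlinarith [mul_self_nonneg x]

/-- Matrix form of (a): for `B ∈ M_{2×2}(ℤ)` with `(tr B)² − 4 det B` not a square, `B 0 1 * B 1 0 ≠ 0`.
[cite: HertlingLarabi2026b, §7.3 Theorem 7.10 (a), chunk p0017] -/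
theorem entry_mul_ne_zero {B : Matrix (Fin 2) (Fin 2) ℤ} (h : ¬ IsSquare (B.trace ^ 2 - 4 * B.det)) :
    B 0 1 * B 1 0 ≠ 0 := by
  rw [Matrix.trace_fin_two, Matrix.det_fin_two] at h
  exact mul_ne_zero_of_not_isSquare h

/-- Matrix form of (a), type V: for `(tr B)² − 4 det B < 0`, `B 0 1 * B 1 0 < 0`.
[cite: HertlingLarabi2026b, §7.3 Theorem 7.10 (a), chunk p0017] -/
theorem entry_mul_neg {B : Matrix (Fin 2) (Fin 2) ℤ} (h : B.trace ^ 2 - 4 * B.det < 0) :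
    B 0 1 * B 1 0 < 0 := by
  rw [Matrix.trace_fin_two, Matrix.det_fin_two] at h
  exact mul_neg_of_discr_neg h

/-- **The hypothesis «`f = t² − rt + s` irreducible» in the form used in the proofs**: a monic integer quadratic
is irreducible over `ℚ` iff its discriminant `r² − 4s` (`= 4D`) is not a square in `ℤ` (HL, proof of (a): «`4D`
is not a square because `f` is irreducible»; types IV and V of Lemma 7.6 (e), (f)).
[cite: HertlingLarabi2026b, §7.3 Theorem 7.10 (a) (proof) with §7.2 Lemma 7.6 (e)(f), chunks p0015, p0017] -/
theorem irreducible_iff_not_isSquare (r s : ℤ) :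
    Irreducible (X ^ 2 - C (r : ℚ) * X + C (s : ℚ) : ℚ[X]) ↔ ¬ IsSquare (r ^ 2 - 4 * s) := by
  have hdeg : (X ^ 2 - C (r : ℚ) * X + C (s : ℚ) : ℚ[X]).natDegree = 2 := by compute_degree!
  have hp0 : (X ^ 2 - C (r : ℚ) * X + C (s : ℚ) : ℚ[X]) ≠ 0 := by
    intro h0
    rw [h0, natDegree_zero] at hdeg
    exact absurd hdeg (by norm_num)
  rw [Polynomial.irreducible_iff_roots_eq_zero_of_degree_le_three (by rw [hdeg]) (by rw [hdeg]; norm_num),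
    Multiset.eq_zero_iff_forall_notMem, ← Rat.isSquare_intCast_iff]
  push_cast
  constructor
  · rintro h ⟨y, hy⟩
    refine h ((y + r) / 2) ?_
    rw [mem_roots hp0, IsRoot.def]
    simp only [eval_add, eval_sub, eval_mul, eval_pow, eval_X, eval_C]
    linear_combination (-1 / 4 : ℚ) * hy
  · intro h x hx
    rw [mem_roots hp0, IsRoot.def] at hx
    simp only [eval_add, eval_sub, eval_mul, eval_pow, eval_X, eval_C] at hx
    exact h ⟨2 * x - r, by linear_combination (-4 : ℚ) * hx⟩

/-! ## §3 THEOREM 7.10 (b): the bounds; `M(r, s)` is finite, and not empty -/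

/-- **THEOREM 7.10 (b), the case `D < 0`** (proof: «`c² ≤ |b||c| = −bc = ((a−d)/2)² − D ≤ ¼c² − D`, so
`c² ≤ (4/3)|D|` […] `|(a−d)/2| ≤ |c|/2` […] `|b| ≤ ¼c² − D ≤ (4/3)|D|`»), in integers with `4D = (a+d)² − 4(ad−bc)`:
for `0 < |c| ≤ |b|`, `a − d ∈ (−|c|, |c|]` one has `bc < 0`, `3c² ≤ −4D`, `3|b| ≤ −4D`, `|a − d| ≤ |c|`.
[cite: HertlingLarabi2026b, §7.3 Theorem 7.10 (b) (proof, case D < 0), chunk p0017] -/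
theorem bounds_of_discr_neg {a b c d : ℤ} (hc : c ≠ 0) (hcb : |c| ≤ |b|) (h₁ : -|c| < a - d)
    (h₂ : a - d ≤ |c|) (hΔ : (a + d) ^ 2 - 4 * (a * d - b * c) < 0) :
    b * c < 0 ∧ 3 * c ^ 2 ≤ -((a + d) ^ 2 - 4 * (a * d - b * c)) ∧
      3 * |b| ≤ -((a + d) ^ 2 - 4 * (a * d - b * c)) ∧ |a - d| ≤ |c| := by
  have hbc : b * c < 0 := mul_neg_of_discr_neg hΔ
  have hΔ' : (a + d) ^ 2 - 4 * (a * d - b * c) = (a - d) ^ 2 + 4 * (b * c) := by ring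
  have hm : (a - d) ^ 2 ≤ c ^ 2 := by
    rw [← sq_abs c]
    exact sq_le_sq' h₁.le h₂
  have hX : |b| * |c| = -(b * c) := by rw [← abs_mul, abs_of_neg hbc]
  have h3 : |c| * |c| ≤ |b| * |c| := mul_le_mul_of_nonneg_right hcb (abs_nonneg c)
  have hcc : |c| * |c| = c ^ 2 := by rw [← sq, sq_abs]
  have hb1 : |b| ≤ |b| * |c| := le_mul_of_one_le_right (abs_nonneg b) (Int.one_le_abs hc)
  refine ⟨hbc, by linarith, by linarith, abs_le.2 ⟨h₁.le, h₂⟩⟩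

/-- **THEOREM 7.10 (b), the case `D ≥ 0`** (proof: «First we show `bc > 0`. Suppose `bc < 0`. Then
`c² ≤ |b||c| = −bc ≤ ¼c² − D`, so `¾c² ≤ −D < 0`, a contradiction. So `bc > 0`. Then `c² ≤ bc = D − ((a−d)/2)² ≤ D`
[…] `|b| ≤ D` because `|c| ≥ 1`»), in integers: for `0 < |c| ≤ |b|`, `a − d ∈ (−|c|, |c|]` and
`4D = (a+d)² − 4(ad−bc) ≥ 0` one has `bc > 0`, `4c² ≤ 4D`, `4|b| ≤ 4D`, `|a − d| ≤ |c|` (no irreducibility is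
needed for these bounds). [cite: HertlingLarabi2026b, §7.3 Theorem 7.10 (b) (proof, case D > 0), chunk p0017] -/
theorem bounds_of_discr_nonneg {a b c d : ℤ} (hc : c ≠ 0) (hcb : |c| ≤ |b|) (h₁ : -|c| < a - d)
    (h₂ : a - d ≤ |c|) (hΔ : 0 ≤ (a + d) ^ 2 - 4 * (a * d - b * c)) :
    0 < b * c ∧ 4 * c ^ 2 ≤ (a + d) ^ 2 - 4 * (a * d - b * c) ∧
      4 * |b| ≤ (a + d) ^ 2 - 4 * (a * d - b * c) ∧ |a - d| ≤ |c| := by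
  have hΔ' : (a + d) ^ 2 - 4 * (a * d - b * c) = (a - d) ^ 2 + 4 * (b * c) := by ring
  have hm : (a - d) ^ 2 ≤ c ^ 2 := by
    rw [← sq_abs c]
    exact sq_le_sq' h₁.le h₂
  have h3 : |c| * |c| ≤ |b| * |c| := mul_le_mul_of_nonneg_right hcb (abs_nonneg c)
  have hcc : |c| * |c| = c ^ 2 := by rw [← sq, sq_abs]
  have hb1 : |b| ≤ |b| * |c| := le_mul_of_one_le_right (abs_nonneg b) (Int.one_le_abs hc)
  have hc2 : 0 < c ^ 2 := by positivity
  have hb : b ≠ 0 := by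
    rintro rfl
    rw [abs_zero] at hcb
    exact hc (abs_nonpos_iff.1 hcb)
  have hbc : 0 < b * c := by
    rcases lt_or_gt_of_ne (mul_ne_zero hb hc) with hneg | hpos
    · exfalso
      have hX : |b| * |c| = -(b * c) := by rw [← abs_mul, abs_of_neg hneg]
      linarith
    · exact hpos
  have hX : |b| * |c| = b * c := by rw [← abs_mul, abs_of_pos hbc]
  refine ⟨hbc, by linarith [sq_nonneg (a - d)], by linarith [sq_nonneg (a - d)], abs_le.2 ⟨h₁.le, h₂⟩⟩

/-- Crude common bounds for the entries of a matrix in `M(r, s)`: `|a|, |b|, |c| ≤ |r² − 4s| + |r|`.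
[cite: HertlingLarabi2026b, §7.3 Theorem 7.10 (b) (proof), chunk p0017] -/
theorem abs_le_of_mem_normalForms {a b c d : ℤ} (hc : c ≠ 0) (hcb : |c| ≤ |b|) (h₁ : -|c| < a - d)
    (h₂ : a - d ≤ |c|) :
    |a| ≤ |(a + d) ^ 2 - 4 * (a * d - b * c)| + |a + d| ∧
      |b| ≤ |(a + d) ^ 2 - 4 * (a * d - b * c)| + |a + d| ∧
        |c| ≤ |(a + d) ^ 2 - 4 * (a * d - b * c)| + |a + d| := by
  have hcsq : |c| ≤ c ^ 2 := by
    rw [← sq_abs]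
    nlinarith [Int.one_le_abs hc]
  have hr : 0 ≤ |a + d| := abs_nonneg _
  have hrle : -|a + d| ≤ a + d ∧ a + d ≤ |a + d| := ⟨neg_abs_le _, le_abs_self _⟩
  rcases lt_or_ge ((a + d) ^ 2 - 4 * (a * d - b * c)) 0 with hneg | hnn
  · obtain ⟨-, hc2, hb3, -⟩ := bounds_of_discr_neg hc hcb h₁ h₂ hneg
    rw [abs_of_neg hneg]
    have hb0 : 0 ≤ |b| := abs_nonneg b
    refine ⟨abs_le.2 ⟨by linarith, by linarith⟩, by linarith, by linarith⟩
  · obtain ⟨-, hc2, hb4, -⟩ := bounds_of_discr_nonneg hc hcb h₁ h₂ hnn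
    rw [abs_of_nonneg hnn]
    have hb0 : 0 ≤ |b| := abs_nonneg b
    refine ⟨abs_le.2 ⟨by linarith, by linarith⟩, by linarith, by linarith⟩

/-- **THEOREM 7.10 (b), first half: `M(r, s)` is finite** — for EVERY `r, s ∈ ℤ` (the printed bounds hold in both
cases `D < 0` and `D ≥ 0`). [cite: HertlingLarabi2026b, §7.3 Theorem 7.10 (b), chunk p0017] -/
theorem finite_normalForms (r s : ℤ) :
    {B : Matrix (Fin 2) (Fin 2) ℤ | B.trace = r ∧ B.det = s ∧ B 1 0 ≠ 0 ∧ |B 1 0| ≤ |B 0 1| ∧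
      -|B 1 0| < B 0 0 - B 1 1 ∧ B 0 0 - B 1 1 ≤ |B 1 0| ∧ (|B 1 0| = |B 0 1| → 0 ≤ B 0 0 - B 1 1)}.Finite := by
  set N : ℤ := |r ^ 2 - 4 * s| + |r| with hN
  refine (((Set.finite_Icc (-N) N).prod ((Set.finite_Icc (-N) N).prod (Set.finite_Icc (-N) N))).image
    (fun p : ℤ × ℤ × ℤ => (!![p.1, p.2.1; p.2.2, r - p.1] : Matrix (Fin 2) (Fin 2) ℤ))).subset ?_
  rintro B ⟨htr, hdet, hc, hcb, h₁, h₂, -⟩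
  rw [Matrix.trace_fin_two] at htr
  rw [Matrix.det_fin_two] at hdet
  obtain ⟨ha, hb, hc'⟩ := abs_le_of_mem_normalForms hc hcb h₁ h₂
  have hΔ : (B 0 0 + B 1 1) ^ 2 - 4 * (B 0 0 * B 1 1 - B 0 1 * B 1 0) = r ^ 2 - 4 * s := by rw [htr, hdet]
  rw [hΔ, htr, ← hN] at ha hb hc'
  refine ⟨(B 0 0, B 0 1, B 1 0), ⟨Set.mem_Icc.2 (abs_le.1 ha), Set.mem_Icc.2 (abs_le.1 hb),
    Set.mem_Icc.2 (abs_le.1 hc')⟩, ?_⟩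
  change (!![B 0 0, B 0 1; B 1 0, r - B 0 0] : Matrix (Fin 2) (Fin 2) ℤ) = B
  rw [show r - B 0 0 = B 1 1 by omega]
  exact (Matrix.eta_fin_two B).symm

/-! ## §4 THEOREM 7.10 (c)(i): Legendre's algorithm — every class meets `M(r, s)` -/

/-- Step 1, the shift: for `C > 0` and `t ∈ ℤ`, `t + 2C·⌊(C − t)/(2C)⌋ ∈ (−C, C]`. [folklore] -/
private theorem shift_aux {C : ℤ} (hC : 0 < C) (t : ℤ) :
    -C < t + 2 * C * ((C - t) / (2 * C)) ∧ t + 2 * C * ((C - t) / (2 * C)) ≤ C := by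
  have h := Int.mul_ediv_add_emod (C - t) (2 * C)
  have h0 := Int.emod_nonneg (C - t) (show 2 * C ≠ 0 by omega)
  have h1 := Int.emod_lt_of_pos (C - t) (show 0 < 2 * C by omega)
  constructor <;> linarith

/-- **Step 1 of the algorithm**: for `c ≠ 0` there is `k ∈ ℤ` with `a − d − 2kc ∈ (−|c|, |c|]` (HL: «the unique
`k ∈ ℤ`»; uniqueness is not needed). [cite: HertlingLarabi2026b, §7.3 Theorem 7.10 (c)(i) Step 1, chunk p0018] -/
theorem exists_shift_mem_Ioc {c : ℤ} (hc : c ≠ 0) (t : ℤ) :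
    ∃ k : ℤ, -|c| < t - 2 * k * c ∧ t - 2 * k * c ≤ |c| := by
  rcases lt_or_gt_of_ne hc with hneg | hpos
  · refine ⟨(-c - t) / (2 * -c), ?_⟩
    have e : t - 2 * ((-c - t) / (2 * -c)) * c = t + 2 * -c * ((-c - t) / (2 * -c)) := by ring
    rw [e, abs_of_neg hneg]
    exact shift_aux (by omega) t
  · refine ⟨-((c - t) / (2 * c)), ?_⟩
    have e : t - 2 * -((c - t) / (2 * c)) * c = t + 2 * c * ((c - t) / (2 * c)) := by ring
    rw [e, abs_of_pos hpos]
    exact shift_aux hpos t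

/-- **THEOREM 7.10 (c)(i) — Legendre's reduction, on entries.**  Let `r² − 4s` be a non-square (`f = t² − rt + s`
irreducible).  Every `(a b; c d) ∈ M_{2×2}(ℤ)` with `a + d = r`, `ad − bc = s` is `SL₂(ℤ)`-conjugate
(`γ · B' = B · γ`, `det γ = 1`, i.e. `B' = γ⁻¹Bγ`) to some `(a' b'; c' d') ∈ M(r, s)`.  Proof = the printed
algorithm, as a strong induction on `|c|`: Step 1 (`T^{−k}·T^k`, `a − d ↦ a − d − 2kc ∈ (−|c|, |c|]`), Step 2
(`S⁻¹·S` when `|b| < |c|`, which lowers `|c|`; `b ≠ 0` by (a)), Step 3 (stop, or one more `S⁻¹·S` when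
`|c| = |b|` and `a − d < 0`). [cite: HertlingLarabi2026b, §7.3 Theorem 7.10 (c)(i) with proof (Steps 1–3), chunks p0017–p0018] -/
theorem exists_sl2_conj_normalForm {r s : ℤ} (hΔ : ¬ IsSquare (r ^ 2 - 4 * s)) (n : ℕ) :
    ∀ a b c d : ℤ, a + d = r → a * d - b * c = s → c.natAbs = n →
      ∃ a' b' c' d' : ℤ, (a' + d' = r ∧ a' * d' - b' * c' = s ∧ c' ≠ 0 ∧ |c'| ≤ |b'| ∧
          -|c'| < a' - d' ∧ a' - d' ≤ |c'| ∧ (|c'| = |b'| → 0 ≤ a' - d')) ∧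
        ∃ γ : Matrix (Fin 2) (Fin 2) ℤ, γ.det = 1 ∧ γ * !![a', b'; c', d'] = !![a, b; c, d] * γ := by
  induction n using Nat.strong_induction_on with
  | _ n ih =>
  intro a b c d htr hdet hn
  -- (a): `c ≠ 0`
  have hD : (a + d) ^ 2 - 4 * (a * d - b * c) = r ^ 2 - 4 * s := by rw [htr, hdet]
  have hbc : b * c ≠ 0 := mul_ne_zero_of_not_isSquare (by rw [hD]; exact hΔ)
  have hc : c ≠ 0 := fun h => hbc (by rw [h, mul_zero])
  -- Step 1: shift by `T^k`
  obtain ⟨k, hk₁, hk₂⟩ := exists_shift_mem_Ioc hc (a - d)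
  have htr₁ : (a - k * c) + (d + k * c) = r := by rw [← htr]; ring
  have hdet₁ : (a - k * c) * (d + k * c) - (b + k * (a - d) - k ^ 2 * c) * c = s := by rw [← hdet]; ring
  have had₁ : (a - k * c) - (d + k * c) = (a - d) - 2 * k * c := by ring
  have hconj₁ : ∃ γ : Matrix (Fin 2) (Fin 2) ℤ, γ.det = 1 ∧
      γ * !![a - k * c, b + k * (a - d) - k ^ 2 * c; c, d + k * c] = !![a, b; c, d] * γ :=
    ⟨!![1, k; 0, 1], det_T k, T_conj a b c d k⟩
  -- (a) again: the new `b` is `≠ 0`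
  have hD₁ : ((a - k * c) + (d + k * c)) ^ 2 - 4 * ((a - k * c) * (d + k * c) -
      (b + k * (a - d) - k ^ 2 * c) * c) = r ^ 2 - 4 * s := by rw [htr₁, hdet₁]
  have hb₁c : (b + k * (a - d) - k ^ 2 * c) * c ≠ 0 := mul_ne_zero_of_not_isSquare (by rw [hD₁]; exact hΔ)
  have hb₁ : b + k * (a - d) - k ^ 2 * c ≠ 0 := fun h => hb₁c (by rw [h, zero_mul])
  rcases lt_or_ge |b + k * (a - d) - k ^ 2 * c| |c| with hlt | hge
  · -- Step 2: conjugate by `S`; `|c|` drops; induction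
    have hconj₂ : ∃ γ : Matrix (Fin 2) (Fin 2) ℤ, γ.det = 1 ∧
        γ * !![d + k * c, -c; -(b + k * (a - d) - k ^ 2 * c), a - k * c] =
          !![a - k * c, b + k * (a - d) - k ^ 2 * c; c, d + k * c] * γ :=
      ⟨!![0, -1; 1, 0], det_S, S_conj _ _ _ _⟩
    have hn' : (-(b + k * (a - d) - k ^ 2 * c)).natAbs < n := by
      rw [Int.natAbs_neg, ← hn]
      have h' : ((b + k * (a - d) - k ^ 2 * c).natAbs : ℤ) < (c.natAbs : ℤ) := by
        rwa [Int.natCast_natAbs, Int.natCast_natAbs]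
      exact_mod_cast h'
    obtain ⟨a', b', c', d', hM, hconj'⟩ := ih _ hn' (d + k * c) (-c) (-(b + k * (a - d) - k ^ 2 * c))
      (a - k * c) (by rw [← htr₁]; ring) (by rw [← hdet₁]; ring) rfl
    exact ⟨a', b', c', d', hM, conj_trans hconj₁ (conj_trans hconj₂ hconj')⟩
  · -- Step 3
    rcases hge.lt_or_eq with hgt | heq
    · -- `|c| < |b|`: stop
      exact ⟨a - k * c, b + k * (a - d) - k ^ 2 * c, c, d + k * c,
        ⟨htr₁, hdet₁, hc, hge, by rw [had₁]; exact hk₁, by rw [had₁]; exact hk₂, fun h => absurd h hgt.ne⟩,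
        hconj₁⟩
    · by_cases h0 : 0 ≤ (a - k * c) - (d + k * c)
      · -- `|c| = |b|`, `a − d ≥ 0`: stop
        exact ⟨a - k * c, b + k * (a - d) - k ^ 2 * c, c, d + k * c,
          ⟨htr₁, hdet₁, hc, hge, by rw [had₁]; exact hk₁, by rw [had₁]; exact hk₂, fun _ => h0⟩, hconj₁⟩
      · -- `|c| = |b|`, `a − d < 0`: one more conjugation by `S`
        push Not at h0
        have hconj₂ : ∃ γ : Matrix (Fin 2) (Fin 2) ℤ, γ.det = 1 ∧
            γ * !![d + k * c, -c; -(b + k * (a - d) - k ^ 2 * c), a - k * c] =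
              !![a - k * c, b + k * (a - d) - k ^ 2 * c; c, d + k * c] * γ :=
          ⟨!![0, -1; 1, 0], det_S, S_conj _ _ _ _⟩
        refine ⟨d + k * c, -c, -(b + k * (a - d) - k ^ 2 * c), a - k * c,
          ⟨by rw [← htr₁]; ring, by rw [← hdet₁]; ring, neg_ne_zero.2 hb₁, ?_, ?_, ?_, ?_⟩,
          conj_trans hconj₁ hconj₂⟩
        · rw [abs_neg, abs_neg]; exact heq.ge
        · rw [abs_neg]; linarith [abs_nonneg (b + k * (a - d) - k ^ 2 * c)]
        · rw [abs_neg, ← heq]; linarith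
        · intro; linarith

/-- **THEOREM 7.10 (c)(i), for matrices**: every `B ∈ M_{2×2}(ℤ)` with `(tr B)² − 4 det B` not a square
(irreducible characteristic polynomial `f = t² − (tr B)t + det B`, types IV and V) is `SL₂(ℤ)`-conjugate to a
matrix in `M(tr B, det B)` («has representatives in `M(r, s)`»; for type IV these are the **semi-normal forms**,
for type V the **normal form**, (c)(ii)–(iii)).
[cite: HertlingLarabi2026b, §7.3 Theorem 7.10 (c)(i)(ii), chunks p0017–p0018] -/
theorem exists_sl2_conj_mem {B : Matrix (Fin 2) (Fin 2) ℤ} (hB : ¬ IsSquare (B.trace ^ 2 - 4 * B.det)) :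
    ∃ M ∈ {M : Matrix (Fin 2) (Fin 2) ℤ | M.trace = B.trace ∧ M.det = B.det ∧ M 1 0 ≠ 0 ∧ |M 1 0| ≤ |M 0 1| ∧
        -|M 1 0| < M 0 0 - M 1 1 ∧ M 0 0 - M 1 1 ≤ |M 1 0| ∧ (|M 1 0| = |M 0 1| → 0 ≤ M 0 0 - M 1 1)},
      ∃ γ : Matrix (Fin 2) (Fin 2) ℤ, γ.det = 1 ∧ γ * M = B * γ := by
  obtain ⟨a', b', c', d', ⟨htr, hdet, hM⟩, hconj⟩ := exists_sl2_conj_normalForm hB _ (B 0 0) (B 0 1)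
    (B 1 0) (B 1 1) (Matrix.trace_fin_two B).symm (Matrix.det_fin_two B).symm rfl
  refine ⟨!![a', b'; c', d'], ⟨by rw [Matrix.trace_fin_two_of, htr], by rw [Matrix.det_fin_two_of, hdet],
    by simpa using hM⟩, ?_⟩
  rw [← Matrix.eta_fin_two B] at hconj
  exact hconj

/-- **THEOREM 7.10 (b), second half: `M(r, s)` is not empty** for `r² − 4s` not a square («because of part
(c)(i) and because one has always the `SL_2(ℤ)`-conjugacy class of the matrix `(0 −s; 1 r)`»).
[cite: HertlingLarabi2026b, §7.3 Theorem 7.10 (b), chunks p0017–p0018] -/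
theorem normalForms_nonempty {r s : ℤ} (h : ¬ IsSquare (r ^ 2 - 4 * s)) :
    {B : Matrix (Fin 2) (Fin 2) ℤ | B.trace = r ∧ B.det = s ∧ B 1 0 ≠ 0 ∧ |B 1 0| ≤ |B 0 1| ∧
      -|B 1 0| < B 0 0 - B 1 1 ∧ B 0 0 - B 1 1 ≤ |B 1 0| ∧ (|B 1 0| = |B 0 1| → 0 ≤ B 0 0 - B 1 1)}.Nonempty := by
  have htr : (!![0, -s; 1, r] : Matrix (Fin 2) (Fin 2) ℤ).trace = r := by
    rw [Matrix.trace_fin_two_of, zero_add]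
  have hdet : (!![0, -s; 1, r] : Matrix (Fin 2) (Fin 2) ℤ).det = s := by
    rw [Matrix.det_fin_two_of]; ring
  have hB : ¬ IsSquare ((!![0, -s; 1, r] : Matrix (Fin 2) (Fin 2) ℤ).trace ^ 2 -
      4 * (!![0, -s; 1, r] : Matrix (Fin 2) (Fin 2) ℤ).det) := by
    rw [htr, hdet]; exact h
  obtain ⟨M, hM, -⟩ := exists_sl2_conj_mem hB
  rw [htr, hdet] at hM
  exact ⟨M, hM⟩

/-! ## §5 THEOREM 7.10 (c)(iii): type V (`D < 0`) — the normal form is unique -/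

/-- **(c)(iii), proof: «Either all matrices `(a b; c d)` in it satisfy `c > 0` (1st case) or all matrices in it
satisfy `c < 0` (2nd case)»** — for `D < 0` the sign of `c` is an `SL₂(ℤ)`-conjugacy invariant (the form
`[c, d − a, −b]` is positive resp. negative definite, and `c' = q_B(p, r)` for `γ = (p q; r s)`, Lemma 7.2 (b)).
[cite: HertlingLarabi2026b, §7.3 Theorem 7.10 (c)(iii) (proof), chunk p0018] -/
theorem pos_of_sl2_conj_of_pos {B B' γ : Matrix (Fin 2) (Fin 2) ℤ} (hΔ : B.trace ^ 2 - 4 * B.det < 0)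
    (hγ : γ.det = 1) (h : γ * B' = B * γ) (hc : 0 < B 1 0) : 0 < B' 1 0 := by
  obtain ⟨htr, -⟩ := trace_eq_and_det_eq_of_sl2_conj hγ h
  obtain ⟨p, q, r, s, hdet1, hg⟩ := (exists_sl_conj_iff_properEquiv htr.symm).1 ⟨γ, hγ, h⟩
  have hc' : B' 1 0 = (⟨B 1 0, B 1 1 - B 0 0, -B 0 1⟩ : BinQF).eval p r := by
    have h1 := congrArg BinQF.a hg
    rwa [BinQF.a_act] at h1
  have hpr : p ≠ 0 ∨ r ≠ 0 := by
    by_contra h0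
    push Not at h0
    rw [h0.1, h0.2] at hdet1
    simp at hdet1
  have hdisc : (⟨B 1 0, B 1 1 - B 0 0, -B 0 1⟩ : BinQF).disc < 0 := by rw [disc_eq]; exact hΔ
  rw [hc']
  exact BinQF.eval_pos _ hc hdisc hpr

/-- For `D < 0`: `c > 0 ⟺ c' > 0` for `SL₂(ℤ)`-conjugate `B, B'` (the two cases of (c)(iii)).
[cite: HertlingLarabi2026b, §7.3 Theorem 7.10 (c)(iii) (proof), chunk p0018] -/
theorem pos_iff_pos_of_sl2_conj {B B' γ : Matrix (Fin 2) (Fin 2) ℤ} (hΔ : B.trace ^ 2 - 4 * B.det < 0)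
    (hγ : γ.det = 1) (h : γ * B' = B * γ) : 0 < B 1 0 ↔ 0 < B' 1 0 := by
  refine ⟨pos_of_sl2_conj_of_pos hΔ hγ h, fun hc' => ?_⟩
  obtain ⟨htr, hdet⟩ := trace_eq_and_det_eq_of_sl2_conj hγ h
  obtain ⟨δ, hδ, hδB⟩ := conj_symm ⟨γ, hγ, h⟩
  exact pos_of_sl2_conj_of_pos (by rw [htr, hdet]; exact hΔ) hδ hδB hc'

/-- **HL's boundary conventions versus Cox's**: for `c ≠ 0`, `(a b; c d)` satisfies the conditions of `M(r, s)`
(`|c| ≤ |b|`, `a − d ∈ (−|c|, |c|]`, `|c| = |b| ⟹ a − d ≥ 0`) iff the form `[|c|, a − d, |b|]` is **reduced** in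
the sense of Cox (2.4) / the tree's `BinQF.IsReduced` (`|a − d| ≤ |c| ≤ |b|`, and `a − d ≥ 0` if `|a − d| = |c|`
or `|c| = |b|`).  For `c > 0` (and `b < 0`) this form is `[c, a − d, −b]`, the form of the matrix `(d b; c a)`,
i.e. the OPPOSITE `[c, −(d − a), −b]` of HL's `[c, d − a, −b]` (HL's domain `F_1` is the mirror image of Cox's);
for `c < 0` (and `b > 0`) it is `−[c, d − a, −b]`.
[cite: HertlingLarabi2026b, §7.3 Theorem 7.10 (b) (definition of M(r, s)) and (c)(iii) (F_1, F_2), chunks p0017–p0018] -/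
theorem mem_normalForms_iff_isReduced {a b c d : ℤ} (hc : c ≠ 0) :
    (|c| ≤ |b| ∧ -|c| < a - d ∧ a - d ≤ |c| ∧ (|c| = |b| → 0 ≤ a - d)) ↔
      (⟨|c|, a - d, |b|⟩ : BinQF).IsReduced := by
  simp only [BinQF.IsReduced]
  constructor
  · rintro ⟨h1, h2, h3, h4⟩
    refine ⟨abs_le.2 ⟨h2.le, h3⟩, h1, ?_⟩
    rintro (h | h)
    · rcases (abs_eq (abs_nonneg c)).1 h with h' | h'
      · rw [h']; exact abs_nonneg c
      · linarith
    · exact h4 h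
  · rintro ⟨h1, h2, h3⟩
    obtain ⟨h1a, h1b⟩ := abs_le.1 h1
    refine ⟨h2, lt_of_le_of_ne h1a ?_, h1b, fun h => h3 (Or.inr h)⟩
    intro h
    have h' : |a - d| = |c| := by rw [← h, abs_neg, abs_abs]
    have := h3 (Or.inl h')
    have hc0 : 0 < |c| := abs_pos.2 hc
    linarith

/-- Scaling a form commutes with the action of a matrix. [folklore] -/
private theorem act_smul (g a b c p q r s : ℤ) :
    (⟨g * a, g * b, g * c⟩ : BinQF).act p q r s =
      ⟨g * ((⟨a, b, c⟩ : BinQF).act p q r s).a, g * ((⟨a, b, c⟩ : BinQF).act p q r s).b,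
        g * ((⟨a, b, c⟩ : BinQF).act p q r s).c⟩ := by
  ext <;> simp only [BinQF.act] <;> ring

/-- The opposite form `[a, −b, c]` transforms with the conjugated matrix `(p −q; −r s)`. [folklore] -/
private theorem act_op (a b c p q r s : ℤ) :
    (⟨a, -b, c⟩ : BinQF).act p (-q) (-r) s =
      ⟨((⟨a, b, c⟩ : BinQF).act p q r s).a, -((⟨a, b, c⟩ : BinQF).act p q r s).b,
        ((⟨a, b, c⟩ : BinQF).act p q r s).c⟩ := by
  ext <;> simp only [BinQF.act] <;> ring

/-- The negative form `−[a, b, c]` transforms with the same matrix. [folklore] -/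
private theorem act_neg (a b c p q r s : ℤ) :
    (⟨-a, -b, -c⟩ : BinQF).act p q r s =
      ⟨-((⟨a, b, c⟩ : BinQF).act p q r s).a, -((⟨a, b, c⟩ : BinQF).act p q r s).b,
        -((⟨a, b, c⟩ : BinQF).act p q r s).c⟩ := by
  ext <;> simp only [BinQF.act] <;> ring

/-- `g·x ≤ g·y ⟺ x ≤ y` for `g > 0`. [folklore] -/
private theorem mul_le_mul_iff' {g : ℤ} (hg : 0 < g) (x y : ℤ) : g * x ≤ g * y ↔ x ≤ y :=
  ⟨fun h => Int.le_of_mul_le_mul_left h hg, fun h => Int.mul_le_mul_of_nonneg_left h hg.le⟩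

/-- Reducedness is invariant under scaling by `g > 0`. [folklore] -/
private theorem isReduced_smul_iff {g : ℤ} (hg : 0 < g) (a b c : ℤ) :
    (⟨g * a, g * b, g * c⟩ : BinQF).IsReduced ↔ (⟨a, b, c⟩ : BinQF).IsReduced := by
  simp only [BinQF.IsReduced, abs_mul, abs_of_pos hg, mul_le_mul_iff' hg,
    (mul_right_injective₀ hg.ne').eq_iff, mul_nonneg_iff_of_pos_left hg]

/-- **Cox's Thm. 2.8 (uniqueness) for arbitrary — not necessarily primitive — positive definite forms**: two
properly equivalent REDUCED forms with `a > 0` and `D < 0` are equal.  (Divide by the content `g = gcd(a, b, c)`,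
an invariant of proper equivalence; `f/g` is primitive, positive definite, reduced; apply the tree's
`eq_of_properEquiv_of_isReduced`.)  This is the form-side statement behind (c)(iii) — HL cite [Se73] for the
fundamental domain instead. [cite: HertlingLarabi2026b, §7.3 Theorem 7.10 (c)(iii), chunk p0018] -/
theorem binQF_eq_of_properEquiv_of_isReduced {f f' : BinQF} (ha : 0 < f.a) (hD : f.disc < 0)
    (hfr : f.IsReduced) (hfr' : f'.IsReduced) (h : f.ProperEquiv f') : f = f' := by
  -- the content `g`
  set g : ℕ := Nat.gcd (Nat.gcd f.a.natAbs f.b.natAbs) f.c.natAbs with hg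
  have hg0 : 0 < g :=
    Nat.gcd_pos_of_pos_left _ (Nat.gcd_pos_of_pos_left _ (Int.natAbs_pos.2 ha.ne'))
  have hgz : (0 : ℤ) < g := by exact_mod_cast hg0
  have hga : (g : ℤ) ∣ f.a :=
    Int.ofNat_dvd_left.2 ((Nat.gcd_dvd_left _ _).trans (Nat.gcd_dvd_left _ _))
  have hgb : (g : ℤ) ∣ f.b :=
    Int.ofNat_dvd_left.2 ((Nat.gcd_dvd_left _ _).trans (Nat.gcd_dvd_right _ _))
  have hgc : (g : ℤ) ∣ f.c := Int.ofNat_dvd_left.2 (Nat.gcd_dvd_right _ _)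
  obtain ⟨p, q, r, s, hdet, hf'⟩ := h
  obtain ⟨hga', hgb', hgc'⟩ := f.dvd_act hga hgb hgc p q r s
  rw [← hf'] at hga' hgb' hgc'
  obtain ⟨a₀, ha₀⟩ := hga
  obtain ⟨b₀, hb₀⟩ := hgb
  obtain ⟨c₀, hc₀⟩ := hgc
  obtain ⟨a₁, ha₁⟩ := hga'
  obtain ⟨b₁, hb₁⟩ := hgb'
  obtain ⟨c₁, hc₁⟩ := hgc'
  have hf₀ : f = ⟨g * a₀, g * b₀, g * c₀⟩ := BinQF.ext ha₀ hb₀ hc₀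
  have hf₁ : f' = ⟨g * a₁, g * b₁, g * c₁⟩ := BinQF.ext ha₁ hb₁ hc₁
  -- `f₀ = f/g` is primitive, positive definite, reduced; `f₁ = f'/g = f₀·γ`
  have hprim : (⟨a₀, b₀, c₀⟩ : BinQF).IsPrimitive := by
    unfold BinQF.IsPrimitive
    have h1 : g * 1 = g * Nat.gcd (Nat.gcd a₀.natAbs b₀.natAbs) c₀.natAbs := by
      conv_lhs => rw [mul_one, hg, ha₀, hb₀, hc₀]
      simp only [Int.natAbs_mul, Int.natAbs_natCast, Nat.gcd_mul_left]
    exact (Nat.eq_of_mul_eq_mul_left hg0 h1).symm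
  have ha₀pos : 0 < a₀ := by
    rw [ha₀] at ha
    exact pos_of_mul_pos_right ha hgz.le
  have hdisc : f.disc = (g : ℤ) ^ 2 * (⟨a₀, b₀, c₀⟩ : BinQF).disc := by
    rw [hf₀]; simp only [BinQF.disc]; ring
  have hD₀ : (⟨a₀, b₀, c₀⟩ : BinQF).disc < 0 := by
    rw [hdisc] at hD
    nlinarith [sq_nonneg (g : ℤ)]
  have hact : (⟨a₁, b₁, c₁⟩ : BinQF) = (⟨a₀, b₀, c₀⟩ : BinQF).act p q r s := by
    have h1 := hf'
    rw [hf₀, hf₁, act_smul] at h1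
    simp only [BinQF.mk.injEq] at h1
    obtain ⟨h1, h2, h3⟩ := h1
    exact BinQF.ext (mul_left_cancel₀ hgz.ne' h1) (mul_left_cancel₀ hgz.ne' h2) (mul_left_cancel₀ hgz.ne' h3)
  have hpos₀ : (⟨a₀, b₀, c₀⟩ : BinQF).IsPosPrim (⟨a₀, b₀, c₀⟩ : BinQF).disc := ⟨rfl, ha₀pos, hprim⟩
  have hequiv : (⟨a₀, b₀, c₀⟩ : BinQF).ProperEquiv ⟨a₁, b₁, c₁⟩ := ⟨p, q, r, s, hdet, hact⟩
  have hpos₁ := hequiv.isPosPrim hD₀ hpos₀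
  have hr₀ : (⟨a₀, b₀, c₀⟩ : BinQF).IsReduced := (isReduced_smul_iff hgz a₀ b₀ c₀).1 (hf₀ ▸ hfr)
  have hr₁ : (⟨a₁, b₁, c₁⟩ : BinQF).IsReduced := (isReduced_smul_iff hgz a₁ b₁ c₁).1 (hf₁ ▸ hfr')
  have key := eq_of_properEquiv_of_isReduced hpos₀ hpos₁ hr₀ hr₁ hequiv
  simp only [BinQF.mk.injEq] at key
  obtain ⟨k1, k2, k3⟩ := key
  rw [hf₀, hf₁, k1, k2, k3]

/-- **THEOREM 7.10 (c)(iii): for type V (`D < 0`) the normal form is unique** — two `SL₂(ℤ)`-conjugate matrices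
which both lie in `M(r, s)` are EQUAL. [cite: HertlingLarabi2026b, §7.3 Theorem 7.10 (c)(iii), chunks p0017–p0018] -/
theorem normalForm_unique_of_discr_neg {B B' : Matrix (Fin 2) (Fin 2) ℤ} (hΔ : B.trace ^ 2 - 4 * B.det < 0)
    (hB : B 1 0 ≠ 0 ∧ |B 1 0| ≤ |B 0 1| ∧ -|B 1 0| < B 0 0 - B 1 1 ∧ B 0 0 - B 1 1 ≤ |B 1 0| ∧
      (|B 1 0| = |B 0 1| → 0 ≤ B 0 0 - B 1 1))
    (hB' : B' 1 0 ≠ 0 ∧ |B' 1 0| ≤ |B' 0 1| ∧ -|B' 1 0| < B' 0 0 - B' 1 1 ∧ B' 0 0 - B' 1 1 ≤ |B' 1 0| ∧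
      (|B' 1 0| = |B' 0 1| → 0 ≤ B' 0 0 - B' 1 1))
    {γ : Matrix (Fin 2) (Fin 2) ℤ} (hγ : γ.det = 1) (h : γ * B' = B * γ) : B = B' := by
  obtain ⟨htr, hdet⟩ := trace_eq_and_det_eq_of_sl2_conj hγ h
  obtain ⟨p, q, r, s, hdet1, hg⟩ := (exists_sl_conj_iff_properEquiv htr.symm).1 ⟨γ, hγ, h⟩
  have hbc : B 0 1 * B 1 0 < 0 := entry_mul_neg hΔ
  have hbc' : B' 0 1 * B' 1 0 < 0 := entry_mul_neg (by rw [htr, hdet]; exact hΔ)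
  have htr2 : B' 0 0 + B' 1 1 = B 0 0 + B 1 1 := by
    rw [← Matrix.trace_fin_two, ← Matrix.trace_fin_two]; exact htr
  -- the Cox forms `F = [|c|, a − d, |b|]`, `F'`, are properly equivalent, and determine the matrices
  have hred : (⟨|B 1 0|, B 0 0 - B 1 1, |B 0 1|⟩ : BinQF).IsReduced :=
    (mem_normalForms_iff_isReduced hB.1).1 hB.2
  have hred' : (⟨|B' 1 0|, B' 0 0 - B' 1 1, |B' 0 1|⟩ : BinQF).IsReduced :=
    (mem_normalForms_iff_isReduced hB'.1).1 hB'.2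
  have hFa : 0 < (⟨|B 1 0|, B 0 0 - B 1 1, |B 0 1|⟩ : BinQF).a := abs_pos.2 hB.1
  have hFD : (⟨|B 1 0|, B 0 0 - B 1 1, |B 0 1|⟩ : BinQF).disc < 0 := by
    have hX : |B 1 0| * |B 0 1| = -(B 0 1 * B 1 0) := by rw [← abs_mul, mul_comm, abs_of_neg hbc]
    have e : (⟨|B 1 0|, B 0 0 - B 1 1, |B 0 1|⟩ : BinQF).disc = B.trace ^ 2 - 4 * B.det := by
      simp only [BinQF.disc, Matrix.trace_fin_two, Matrix.det_fin_two]
      rw [mul_assoc, hX]; ring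
    rw [e]; exact hΔ
  rcases lt_or_gt_of_ne hB.1 with hneg | hpos
  · -- 2nd case: `c < 0`, `c' < 0`, `b, b' > 0`; `F = −[c, d − a, −b]`
    have hneg' : B' 1 0 < 0 := by
      rcases lt_or_gt_of_ne hB'.1 with h' | h'
      · exact h'
      · exact absurd ((pos_iff_pos_of_sl2_conj hΔ hγ h).2 h') (lt_asymm hneg)
    have hb : 0 < B 0 1 := by nlinarith
    have hb' : 0 < B' 0 1 := by nlinarith
    have hequiv : (⟨|B 1 0|, B 0 0 - B 1 1, |B 0 1|⟩ : BinQF).ProperEquiv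
        ⟨|B' 1 0|, B' 0 0 - B' 1 1, |B' 0 1|⟩ := by
      refine ⟨p, q, r, s, hdet1, ?_⟩
      rw [abs_of_neg hneg, abs_of_neg hneg', abs_of_pos hb, abs_of_pos hb']
      have e1 : (⟨-B 1 0, B 0 0 - B 1 1, B 0 1⟩ : BinQF) = ⟨-B 1 0, -(B 1 1 - B 0 0), -(-B 0 1)⟩ := by
        ext <;> simp
      have e2 : (⟨-B' 1 0, B' 0 0 - B' 1 1, B' 0 1⟩ : BinQF) = ⟨-B' 1 0, -(B' 1 1 - B' 0 0), -(-B' 0 1)⟩ := by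
        ext <;> simp
      rw [e1, e2, act_neg, ← hg]
    have key := binQF_eq_of_properEquiv_of_isReduced hFa hFD hred hred' hequiv
    simp only [BinQF.mk.injEq] at key
    obtain ⟨k1, k2, k3⟩ := key
    rw [abs_of_neg hneg, abs_of_neg hneg'] at k1
    rw [abs_of_pos hb, abs_of_pos hb'] at k3
    have e00 : B 0 0 = B' 0 0 := by omega
    have e01 : B 0 1 = B' 0 1 := by omega
    have e10 : B 1 0 = B' 1 0 := by omega
    have e11 : B 1 1 = B' 1 1 := by omega
    rw [Matrix.eta_fin_two B, Matrix.eta_fin_two B', e00, e01, e10, e11]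
  · -- 1st case: `c > 0`, `c' > 0`, `b, b' < 0`; `F = [c, −(d − a), −b]`, the opposite form
    have hpos' : 0 < B' 1 0 := (pos_iff_pos_of_sl2_conj hΔ hγ h).1 hpos
    have hb : B 0 1 < 0 := by nlinarith
    have hb' : B' 0 1 < 0 := by nlinarith
    have hequiv : (⟨|B 1 0|, B 0 0 - B 1 1, |B 0 1|⟩ : BinQF).ProperEquiv
        ⟨|B' 1 0|, B' 0 0 - B' 1 1, |B' 0 1|⟩ := by
      refine ⟨p, -q, -r, s, by linear_combination hdet1, ?_⟩
      rw [abs_of_pos hpos, abs_of_pos hpos', abs_of_neg hb, abs_of_neg hb']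
      have e1 : (⟨B 1 0, B 0 0 - B 1 1, -B 0 1⟩ : BinQF) = ⟨B 1 0, -(B 1 1 - B 0 0), -B 0 1⟩ := by
        ext <;> simp
      have e2 : (⟨B' 1 0, B' 0 0 - B' 1 1, -B' 0 1⟩ : BinQF) = ⟨B' 1 0, -(B' 1 1 - B' 0 0), -B' 0 1⟩ := by
        ext <;> simp
      rw [e1, e2, act_op, ← hg]
    have key := binQF_eq_of_properEquiv_of_isReduced hFa hFD hred hred' hequiv
    simp only [BinQF.mk.injEq] at key
    obtain ⟨k1, k2, k3⟩ := key
    rw [abs_of_pos hpos, abs_of_pos hpos'] at k1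
    rw [abs_of_neg hb, abs_of_neg hb'] at k3
    have e00 : B 0 0 = B' 0 0 := by omega
    have e01 : B 0 1 = B' 0 1 := by omega
    have e11 : B 1 1 = B' 1 1 := by omega
    rw [Matrix.eta_fin_two B, Matrix.eta_fin_two B', e00, e01, k1, e11]

/-- **THEOREM 7.10 (c)(i)+(iii) for type V**: for `B ∈ M_{2×2}(ℤ)` with `(tr B)² − 4 det B < 0` there is EXACTLY
ONE `M ∈ M(tr B, det B)` which is `SL₂(ℤ)`-conjugate to `B` — «It is called normal form».
[cite: HertlingLarabi2026b, §7.3 Theorem 7.10 (c)(iii), chunks p0017–p0018] -/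
theorem existsUnique_sl2_conj_mem_of_discr_neg {B : Matrix (Fin 2) (Fin 2) ℤ}
    (hΔ : B.trace ^ 2 - 4 * B.det < 0) :
    ∃! M : Matrix (Fin 2) (Fin 2) ℤ, (M.trace = B.trace ∧ M.det = B.det ∧ M 1 0 ≠ 0 ∧ |M 1 0| ≤ |M 0 1| ∧
        -|M 1 0| < M 0 0 - M 1 1 ∧ M 0 0 - M 1 1 ≤ |M 1 0| ∧ (|M 1 0| = |M 0 1| → 0 ≤ M 0 0 - M 1 1)) ∧
      ∃ γ : Matrix (Fin 2) (Fin 2) ℤ, γ.det = 1 ∧ γ * M = B * γ := by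
  obtain ⟨M, hM, hconj⟩ := exists_sl2_conj_mem (not_isSquare_discr_of_neg hΔ)
  refine ⟨M, ⟨hM, hconj⟩, fun M' ⟨hM', hconj'⟩ => ?_⟩
  obtain ⟨δ, hδ, hδM⟩ := conj_trans (conj_symm hconj) hconj'
  have hΔM : M.trace ^ 2 - 4 * M.det < 0 := by rw [hM.1, hM.2.1]; exact hΔ
  exact (normalForm_unique_of_discr_neg hΔM hM.2.2 hM'.2.2 hδ hδM).symm

/-- **THEOREM 7.10 (b)+(c) for type V, counted: the `SL₂(ℤ)`-conjugacy classes of integer `2 × 2` matrices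
with characteristic polynomial `t² − rt + s`, `r² − 4s < 0`, are in bijection with the finite set `M(r, s)`**
(one normal form per class). [cite: HertlingLarabi2026b, §7.3 Theorem 7.10 (b)(c)(iii), chunks p0017–p0018] -/
theorem natCard_quot_sl2_conj_eq {r s : ℤ} (hΔ : r ^ 2 - 4 * s < 0) :
    Nat.card (Quot fun B B' : {B : Matrix (Fin 2) (Fin 2) ℤ // B.trace = r ∧ B.det = s} =>
        ∃ γ : Matrix (Fin 2) (Fin 2) ℤ, γ.det = 1 ∧ γ * B'.1 = B.1 * γ) =
      Nat.card {B : Matrix (Fin 2) (Fin 2) ℤ | B.trace = r ∧ B.det = s ∧ B 1 0 ≠ 0 ∧ |B 1 0| ≤ |B 0 1| ∧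
        -|B 1 0| < B 0 0 - B 1 1 ∧ B 0 0 - B 1 1 ≤ |B 1 0| ∧ (|B 1 0| = |B 0 1| → 0 ≤ B 0 0 - B 1 1)} := by
  set S := {B : Matrix (Fin 2) (Fin 2) ℤ // B.trace = r ∧ B.det = s}
  set rel : S → S → Prop := fun B B' => ∃ γ : Matrix (Fin 2) (Fin 2) ℤ, γ.det = 1 ∧ γ * B'.1 = B.1 * γ
    with hrel
  have hequiv : Equivalence rel := equivalence_sl2_conj r s
  set N := {B : Matrix (Fin 2) (Fin 2) ℤ | B.trace = r ∧ B.det = s ∧ B 1 0 ≠ 0 ∧ |B 1 0| ≤ |B 0 1| ∧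
    -|B 1 0| < B 0 0 - B 1 1 ∧ B 0 0 - B 1 1 ≤ |B 1 0| ∧ (|B 1 0| = |B 0 1| → 0 ≤ B 0 0 - B 1 1)} with hN
  let φ : N → Quot rel := fun M => Quot.mk rel ⟨M.1, M.2.1, M.2.2.1⟩
  have hφ : Function.Bijective φ := by
    constructor
    · intro M M' hMM'
      have hr : rel ⟨M.1, M.2.1, M.2.2.1⟩ ⟨M'.1, M'.2.1, M'.2.2.1⟩ :=
        hequiv.eqvGen_iff.1 (Quot.eqvGen_exact hMM')
      obtain ⟨γ, hγ, hγM⟩ := hr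
      apply Subtype.ext
      have hΔM : M.1.trace ^ 2 - 4 * M.1.det < 0 := by rw [M.2.1, M.2.2.1]; exact hΔ
      exact normalForm_unique_of_discr_neg hΔM M.2.2.2 M'.2.2.2 hγ hγM
    · intro x
      induction x using Quot.ind with
      | _ B =>
      have hB : ¬ IsSquare (B.1.trace ^ 2 - 4 * B.1.det) :=
        not_isSquare_discr_of_neg (by rw [B.2.1, B.2.2]; exact hΔ)
      obtain ⟨M, hM, hconj⟩ := exists_sl2_conj_mem hB
      rw [B.2.1, B.2.2] at hM
      refine ⟨⟨M, hM⟩, ?_⟩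
      exact Quot.sound (conj_symm hconj)
  exact (Nat.card_congr (Equiv.ofBijective φ hφ)).symm

/-! ## §6 EXAMPLES 7.11 (i): `M(0, 5)` and the four `SL₂(ℤ)`-classes with characteristic polynomial `t² + 5` -/

/-- **EXAMPLES 7.11 (i): `M(0, 5) = {(0 −5; 1 0), (0 5; −1 0), (1 −3; 2 −1), (1 3; −2 −1)}`** (from the bounds of
(b): `3c² ≤ 20`, `2a ∈ (−|c|, |c|]`, `bc = −5 − a²`). [cite: HertlingLarabi2026b, §7.3 Examples 7.11 (i), chunk p0018] -/
theorem normalForms_zero_five :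
    {B : Matrix (Fin 2) (Fin 2) ℤ | B.trace = 0 ∧ B.det = 5 ∧ B 1 0 ≠ 0 ∧ |B 1 0| ≤ |B 0 1| ∧
        -|B 1 0| < B 0 0 - B 1 1 ∧ B 0 0 - B 1 1 ≤ |B 1 0| ∧ (|B 1 0| = |B 0 1| → 0 ≤ B 0 0 - B 1 1)} =
      {!![0, -5; 1, 0], !![0, 5; -1, 0], !![1, -3; 2, -1], !![1, 3; -2, -1]} := by
  ext B
  simp only [Set.mem_setOf_eq, Set.mem_insert_iff, Set.mem_singleton_iff]
  constructor
  · obtain ⟨a, b, c, d, rfl⟩ : ∃ a b c d : ℤ, B = !![a, b; c, d] :=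
      ⟨B 0 0, B 0 1, B 1 0, B 1 1, Matrix.eta_fin_two B⟩
    rintro ⟨htr, hdet, hc, hcb, h₁, h₂, h₃⟩
    rw [Matrix.trace_fin_two_of] at htr
    rw [Matrix.det_fin_two_of] at hdet
    simp only [Matrix.of_apply, Matrix.cons_val', Matrix.cons_val_zero, Matrix.cons_val_one,
      Matrix.cons_val_fin_one, Matrix.empty_val'] at hc hcb h₁ h₂ h₃
    obtain ⟨hbc, hc2, -, -⟩ := bounds_of_discr_neg hc hcb h₁ h₂ (by rw [htr, hdet]; norm_num)
    rw [htr, hdet] at hc2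
    obtain rfl : d = -a := by omega
    rcases lt_or_gt_of_ne hc with hneg | hpos
    · have hb : 0 < b := by nlinarith
      simp only [abs_of_neg hneg, abs_of_pos hb] at hcb h₁ h₂ h₃
      have hc' : -2 ≤ c := by nlinarith
      interval_cases c
      · -- `c = -2`
        have ha : a = 0 ∨ a = 1 := by omega
        rcases ha with rfl | rfl
        · exfalso; omega
        · obtain rfl : b = 3 := by omega
          right; right; right; norm_num
      · -- `c = -1`
        obtain rfl : a = 0 := by omega
        obtain rfl : b = 5 := by omega
        right; left; norm_num
    · have hb : b < 0 := by nlinarith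
      simp only [abs_of_pos hpos, abs_of_neg hb] at hcb h₁ h₂ h₃
      have hc' : c ≤ 2 := by nlinarith
      interval_cases c
      · -- `c = 1`
        obtain rfl : a = 0 := by omega
        obtain rfl : b = -5 := by omega
        left; norm_num
      · -- `c = 2`
        have ha : a = 0 ∨ a = 1 := by omega
        rcases ha with rfl | rfl
        · exfalso; omega
        · obtain rfl : b = -3 := by omega
          right; right; left; norm_num
  · rintro (rfl | rfl | rfl | rfl) <;>
      norm_num [Matrix.trace_fin_two_of, Matrix.det_fin_two_of]

/-- **EXAMPLES 7.11 (i): «Therefore there are four `SL_2(ℤ)`-conjugacy classes» of integer `2 × 2` matrices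
with characteristic polynomial `t² + 5`.** [cite: HertlingLarabi2026b, §7.3 Examples 7.11 (i), chunk p0018] -/
theorem natCard_quot_sl2_conj_zero_five :
    Nat.card (Quot fun B B' : {B : Matrix (Fin 2) (Fin 2) ℤ // B.trace = 0 ∧ B.det = 5} =>
        ∃ γ : Matrix (Fin 2) (Fin 2) ℤ, γ.det = 1 ∧ γ * B'.1 = B.1 * γ) = 4 := by
  rw [natCard_quot_sl2_conj_eq (by norm_num), normalForms_zero_five, Nat.card_coe_set_eq,
    Set.ncard_insert_of_notMem (by decide), Set.ncard_insert_of_notMem (by decide),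
    Set.ncard_pair (by decide)]

end Literature.LinearAlgebra.Matrix.SL2ZIrreducibleNormalForms
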